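import Literature.Analysis.FluidPDE.CheskidovShvydkoyNonlinear
import HarnessLib

/-!
# Skewness of transport and the two-field block expansions of the trilinear pieces

Analysis/FluidPDE support file (serves the discharge of the named fact
`Literature.Analysis.FluidPDE.cheskidov_dai_occupation_regular`, Cheskidov–Dai, arXiv:1507.06611 =
Proc. Edinburgh Math. Soc. (2025), Thm. 1.1, whose §3.1 runs the frequency-localised energy estimate with
Bony's decomposition in commutator form). Complements `CheskidovShvydkoyNonlinear.lean` (the trilinear pieces
`𝒯_j(g; f, w) = ∫ ⟪g, Δ̇_j(⟪f, e⟫ w)⟫` and their block expansions with ONE field in both slots); all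
**proved**:

* `integral_inner_convect_eq_zero` — transport by a divergence-free field is skew on the whole space:
  `∫ ⟪g, (f·∇) g⟫ = 0` for a bounded `f` with bounded derivatives, `div f = 0`, and a smooth `L²` field `g`
  (the paper's "`I₁₂` vanishes since `div u_{≤q-2} = 0`"; one integration by parts per coordinate, no
  boundary terms since `g, ∂_i g ∈ L²`);
* `trilin_blockFn_blockFn_eq_zero'` — vanishing of the far pieces `𝒯_j(g; Δ̇_l v, Δ̇_{l'} w)` for two
  different `L²` fields `v, w` (Fourier supports, `ParaproductVanishing`);
* `trilin_eq_sum_of_vanishing`, `enorm_trilin_le_tsum_left`, `enorm_trilin_le_tsum_right` — the block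
  expansions in either slot: as a finite sum when all other pieces vanish, as a series bound in general.

## References

* A. Cheskidov, M. Dai, arXiv:1507.06611 = Proc. Edinburgh Math. Soc. (2025), §3.1. [CheskidovDai2015]
* H. Bahouri, J.-Y. Chemin, R. Danchin, *Fourier Analysis and Nonlinear PDE*, Springer 2011, §2.6.1
  (Bony's decomposition). [BahouriCheminDanchin2011]
-/

noncomputable section

open MeasureTheory Filter Function Set
open scoped ENNReal NNReal RealInnerProductSpace Topology SchwartzMap
open Literature.Analysis.FunctionSpaces

namespace Literature.Analysis.FluidPDE

/-! ## Transport is skew on the whole space -/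

section Transport

variable {E : Type*} [NormedAddCommGroup E] [InnerProductSpace ℝ E] [FiniteDimensional ℝ E]
  [MeasurableSpace E] [BorelSpace E]
variable {E' : Type*} [NormedAddCommGroup E'] [InnerProductSpace ℝ E']

/-- **Transport by a divergence-free field is skew**: for a bounded field `f : E → E` with bounded
derivatives and `div f = 0`, and a smooth `L²` field `g`, `∫ ⟪g, (f·∇) g⟫ = 0` — componentwise
`⟪g, (f·∇)g⟫ = ∑_i f_i ⟪g, ∂_i g⟫ = ½ ∑_i f_i ∂_i ‖g‖²`, one whole-space integration by parts per
coordinate (all pairings in `L¹` since `g, ∂_i g ∈ L²` and `f, Df` are bounded), and `∑_i ∂_i f_i = 0`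
(Cheskidov–Dai §3.1: "`I₁₂` vanishes since `div u_{≤q-2} = 0`"). [cite: CheskidovDai2015, §3.1 (I₁₂ = 0)] -/
theorem integral_inner_convect_eq_zero {f : E → E} (hf : HasBoundedDerivs f) (hdiv : VectorCalculus.IsDivFree f)
    {g : E → E'} (hg : IsSmoothL2Field g) :
    ∫ x, ⟪g x, convect f g x⟫ = 0 := by
  set b := stdOrthonormalBasis ℝ E
  obtain ⟨M₀, hM₀⟩ := hf.exists_norm_le
  obtain ⟨M₁, hM₁⟩ := hf.exists_norm_fderiv_le
  have hf1 : ContDiff ℝ 1 f := hf.contDiff_nat 1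
  have hg1 : ContDiff ℝ 1 g := hg.contDiff_nat 1
  have hg2 : MemLp g 2 volume := hg.memLp_two
  -- the components `φ_i = ⟪f, b_i⟫` and `G = ⟪g, g⟫`
  set φ : Fin (Module.finrank ℝ E) → E → ℝ := fun i y => ⟪f y, b i⟫ with hφ
  set G : E → ℝ := fun y => ⟪g y, g y⟫ with hG
  set G' : E → E →L[ℝ] ℝ := fun y => (fderivInnerCLM ℝ (g y, g y)).comp ((fderiv ℝ g y).prod (fderiv ℝ g y))
    with hG'
  have hGd : ∀ y, HasFDerivAt G (G' y) y := fun y =>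
    ((hg1.differentiable one_ne_zero y).hasFDerivAt).inner ℝ ((hg1.differentiable one_ne_zero y).hasFDerivAt)
  have hG'v : ∀ y (v : E), G' y v = 2 * ⟪g y, fderiv ℝ g y v⟫ := by
    intro y v
    simp only [hG', ContinuousLinearMap.coe_comp, Function.comp_apply, ContinuousLinearMap.prod_apply,
      fderivInnerCLM_apply, real_inner_comm (g y)]
    ring
  have hφd : ∀ i y, HasFDerivAt (φ i) ((innerSL ℝ (b i)).comp (fderiv ℝ f y)) y := fun i y =>
    hasFDerivAt_inner_const_field hf1 (b i) y
  -- integrability of the three pairings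
  have hGi : Integrable G volume := by
    have := integrable_inner_of_memLp_two hg2 hg2
    exact this
  have hGgi : ∀ i, Integrable (fun y => ⟪g y, fderiv ℝ g y (b i)⟫) volume := fun i =>
    integrable_inner_of_memLp_two hg2 (hg.memLp_fderiv_apply (b i))
  have hφb : ∀ i y, ‖φ i y‖ ≤ M₀ := fun i y => by
    simp only [hφ]
    refine (abs_real_inner_le_norm _ _).trans ?_
    rw [b.orthonormal.1 i, mul_one]
    exact hM₀ y
  have hφ'b : ∀ i y, ‖((innerSL ℝ (b i)).comp (fderiv ℝ f y)) (b i)‖ ≤ M₁ := fun i y => by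
    simp only [ContinuousLinearMap.coe_comp, Function.comp_apply, innerSL_apply_apply]
    refine (abs_real_inner_le_norm _ _).trans ?_
    rw [b.orthonormal.1 i, one_mul]
    exact (ContinuousLinearMap.le_opNorm _ _).trans (by rw [b.orthonormal.1 i, mul_one]; exact hM₁ y)
  have hφc : ∀ i, Continuous (φ i) := fun i => (hf.continuous.inner continuous_const)
  have i1 : ∀ i, Integrable (fun y => φ i y * G' y (b i)) volume := fun i => by
    simp_rw [hG'v]
    exact ((hGgi i).const_mul 2).bdd_mul (hφc i).aestronglyMeasurable (Eventually.of_forall (hφb i))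
  have hφ'c : ∀ i, Continuous (fun y => ((innerSL ℝ (b i)).comp (fderiv ℝ f y)) (b i)) := fun i => by
    have heq : (fun y => ((innerSL ℝ (b i)).comp (fderiv ℝ f y)) (b i)) = fun y => ⟪b i, fderiv ℝ f y (b i)⟫ := by
      funext y; simp only [ContinuousLinearMap.coe_comp, Function.comp_apply, innerSL_apply_apply]
    rw [heq]
    exact continuous_const.inner ((hf1.continuous_fderiv one_ne_zero).clm_apply continuous_const)
  have i2 : ∀ i, Integrable (fun y => ((innerSL ℝ (b i)).comp (fderiv ℝ f y)) (b i) * G y) volume := fun i =>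
    hGi.bdd_mul (hφ'c i).aestronglyMeasurable (Eventually.of_forall (hφ'b i))
  have i3 : ∀ i, Integrable (fun y => φ i y * G y) volume := fun i =>
    hGi.bdd_mul (hφc i).aestronglyMeasurable (Eventually.of_forall (hφb i))
  -- integration by parts, coordinate by coordinate
  have hibp : ∀ i, ∫ y, φ i y * G' y (b i) = -∫ y, ((innerSL ℝ (b i)).comp (fderiv ℝ f y)) (b i) * G y := by
    intro i
    have key := integral_bilinear_hasFDerivAt_right_eq_neg_left_of_integrable (μ := (volume : Measure E))
      (B := ContinuousLinearMap.mul ℝ ℝ) (f := φ i) (f' := fun y => (innerSL ℝ (b i)).comp (fderiv ℝ f y))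
      (g := G) (g' := G') (v := b i) (i2 i) (i1 i) (i3 i) (fun y _ => hφd i y) (fun y _ => hGd y)
    exact key
  -- the divergence-free cancellation
  have hsum0 : ∀ y, ∑ i, ((innerSL ℝ (b i)).comp (fderiv ℝ f y)) (b i) = 0 := by
    intro y
    have h := divergence_eq_sum_inner_fderiv b f y
    simp only [ContinuousLinearMap.coe_comp, Function.comp_apply, innerSL_apply_apply]
    rw [← h]
    exact hdiv y
  -- expand the transport term
  have hexp : ∀ y, ⟪g y, convect f g y⟫ = ∑ i, (2 : ℝ)⁻¹ * (φ i y * G' y (b i)) := by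
    intro y
    rw [convect_apply]
    conv_lhs => rw [← b.sum_repr' (f y)]
    simp only [map_sum, map_smul, inner_sum, inner_smul_right, hG'v, hφ, real_inner_comm (f y)]
    refine Finset.sum_congr rfl fun i _ => by ring
  calc ∫ y, ⟪g y, convect f g y⟫ = ∫ y, ∑ i, (2 : ℝ)⁻¹ * (φ i y * G' y (b i)) := by simp_rw [hexp]
    _ = ∑ i, (2 : ℝ)⁻¹ * ∫ y, φ i y * G' y (b i) := by
        rw [integral_finsetSum _ fun i _ => (i1 i).const_mul _]
        exact Finset.sum_congr rfl fun i _ => integral_const_mul _ _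
    _ = ∑ i, (2 : ℝ)⁻¹ * -∫ y, ((innerSL ℝ (b i)).comp (fderiv ℝ f y)) (b i) * G y := by simp_rw [hibp]
    _ = -(2 : ℝ)⁻¹ * ∑ i, ∫ y, ((innerSL ℝ (b i)).comp (fderiv ℝ f y)) (b i) * G y := by
        rw [Finset.mul_sum]
        exact Finset.sum_congr rfl fun i _ => by ring
    _ = -(2 : ℝ)⁻¹ * ∫ y, ∑ i, ((innerSL ℝ (b i)).comp (fderiv ℝ f y)) (b i) * G y := by
        rw [integral_finsetSum _ fun i _ => i2 i]
    _ = -(2 : ℝ)⁻¹ * ∫ y, (∑ i, ((innerSL ℝ (b i)).comp (fderiv ℝ f y)) (b i)) * G y := by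
        congr 1
        exact integral_congr_ae (Eventually.of_forall fun y => by simp only [Finset.sum_mul])
    _ = 0 := by simp_rw [hsum0, zero_mul, integral_zero, mul_zero]

end Transport

/-! ## Block expansions of the trilinear pieces with two fields -/

section TwoFields

variable {ι : Type*} [Fintype ι]

/-- **Vanishing of the far paraproduct pieces, two fields**: if `(l, l', j)` is a vanishing
configuration then `𝒯_j(g; Δ̇_l v, Δ̇_{l'} w) = 0` for `v, w ∈ L²` (the Fourier-support bookkeeping of Bony's
decomposition). [cite: BahouriCheminDanchin2011, §2.6.1 (Bony's decomposition)] -/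
theorem trilin_blockFn_blockFn_eq_zero' {l l' j : ℤ} (h : ParaproductVanishing l l' j) (g : EuclideanSpace ℝ ι → EuclideanSpace ℝ ι) (e : EuclideanSpace ℝ ι)
    {v w : EuclideanSpace ℝ ι → EuclideanSpace ℝ ι} (hv : MemLp v 2 volume) (hw : MemLp w 2 volume) :
    trilin j g e (blockFn l v) (blockFn l' w) = 0 := by
  unfold trilin
  have hφ : MemLp (fun y => ⟪v y, e⟫) 2 volume := by
    have : (fun y => ⟪v y, e⟫) = fun y => (innerSL ℝ e) (v y) := by
      funext y; rw [innerSL_apply_apply, real_inner_comm]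
    rw [this]
    exact MemLp.of_le_mul (c := ‖innerSL ℝ e‖) hv ((innerSL ℝ e).continuous.comp_aestronglyMeasurable hv.1)
      (Eventually.of_forall fun x => (innerSL ℝ e).le_opNorm _)
  have hzero : blockFn j (fun y => ⟪blockFn l v y, e⟫ • blockFn l' w y) = 0 := by
    have h1 : (fun y => ⟪blockFn l v y, e⟫ • blockFn l' w y) = fun y => blockFn l (fun y => ⟪v y, e⟫) y • blockFn l' w y := by
      funext y; rw [← inner_blockFn_const_eq l hv e]
    rw [h1]
    exact blockFn_smul_eq_zero_real h hφ hw
  simp [hzero]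

/-- **The second slot is recovered from finitely many blocks when the others vanish**: if
`𝒯_j(g; f, Δ̇_{l'} w) = 0` for every `l'` outside a finite set `s`, then
`𝒯_j(g; f, w) = ∑_{l' ∈ s} 𝒯_j(g; f, Δ̇_{l'} w)` (`g, w ∈ L²`, `f ∈ L^∞`, block sums of `w` converging
in `L²`) — Bony's decomposition of the product with all but finitely many pieces vanishing.
[cite: BahouriCheminDanchin2011, §2.6.1 (Bony's decomposition)] -/
theorem trilin_eq_sum_of_vanishing (j : ℤ) {g : EuclideanSpace ℝ ι → EuclideanSpace ℝ ι} (hg : MemLp g 2 volume) {e : EuclideanSpace ℝ ι} (he : ‖e‖ ≤ 1)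
    {f w : EuclideanSpace ℝ ι → EuclideanSpace ℝ ι} (hf : MemLp f ∞ volume) (hw : MemLp w 2 volume)
    (hconv : Tendsto (fun N : ℕ => eLpNorm (w - ∑ l ∈ Finset.Icc (-(N : ℤ)) N, blockFn l w) 2 volume) atTop (𝓝 0))
    (s : Finset ℤ) (hs : ∀ l', l' ∉ s → trilin j g e f (blockFn l' w) = 0) :
    trilin j g e f w = ∑ l' ∈ s, trilin j g e f (blockFn l' w) := by
  have hlim := tendsto_sum_trilin_blockFn_right j hg he hf hw hconv
  -- the partial sums are eventually the sum over `s`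
  obtain ⟨N₀, hN₀⟩ : ∃ N₀ : ℕ, ∀ l' ∈ s, -(N₀ : ℤ) ≤ l' ∧ l' ≤ N₀ := by
    refine ⟨s.sup fun l => l.natAbs, fun l' hl' => ?_⟩
    have h : l'.natAbs ≤ s.sup fun l => l.natAbs := Finset.le_sup (f := fun l : ℤ => l.natAbs) hl'
    constructor <;> omega
  have hev : ∀ N : ℕ, N₀ ≤ N → ∑ l ∈ Finset.Icc (-(N : ℤ)) N, trilin j g e f (blockFn l w) =
      ∑ l' ∈ s, trilin j g e f (blockFn l' w) := by
    intro N hN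
    refine (Finset.sum_subset (fun l' hl' => ?_) fun l' _ hl' => hs l' hl').symm
    have := hN₀ l' hl'
    simp only [Finset.mem_Icc]
    constructor <;> omega
  have hlim' : Tendsto (fun N : ℕ => ∑ l ∈ Finset.Icc (-(N : ℤ)) N, trilin j g e f (blockFn l w)) atTop
      (𝓝 (∑ l' ∈ s, trilin j g e f (blockFn l' w))) :=
    tendsto_const_nhds.congr' (by
      filter_upwards [eventually_ge_atTop N₀] with N hN
      exact (hev N hN).symm)
  exact tendsto_nhds_unique hlim hlim'

/-- **The trilinear piece is dominated by the block sum in the first slot**: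
`‖𝒯_j(g; v, w)‖ ≤ ∑_l ‖𝒯_j(g; Δ̇_l v, w)‖` for `g, v ∈ L²`, `w ∈ L^∞` and block sums of `v` converging
in `L²` (Littlewood–Paley decomposition of the first factor, BCD §2.6.1). [cite: BahouriCheminDanchin2011, §2.6.1 (Bony's decomposition)] -/
theorem enorm_trilin_le_tsum_left (j : ℤ) {g : EuclideanSpace ℝ ι → EuclideanSpace ℝ ι} (hg : MemLp g 2 volume) {e : EuclideanSpace ℝ ι} (he : ‖e‖ ≤ 1)
    {v w : EuclideanSpace ℝ ι → EuclideanSpace ℝ ι} (hv : MemLp v 2 volume) (hw : MemLp w ∞ volume)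
    (hconv : Tendsto (fun N : ℕ => eLpNorm (v - ∑ l ∈ Finset.Icc (-(N : ℤ)) N, blockFn l v) 2 volume) atTop (𝓝 0)) :
    ‖trilin j g e v w‖ₑ ≤ ∑' l, ‖trilin j g e (blockFn l v) w‖ₑ :=
  enorm_le_tsum_of_tendsto_sum (tendsto_sum_trilin_blockFn_left j hg he hv hw hconv)

/-- **The trilinear piece is dominated by the block sum in the second slot**:
`‖𝒯_j(g; f, w)‖ ≤ ∑_{l'} ‖𝒯_j(g; f, Δ̇_{l'} w)‖` for `g, w ∈ L²`, `f ∈ L^∞` and block sums of `w`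
converging in `L²` (Littlewood–Paley decomposition of the second factor, BCD §2.6.1). [cite: BahouriCheminDanchin2011, §2.6.1 (Bony's decomposition)] -/
theorem enorm_trilin_le_tsum_right (j : ℤ) {g : EuclideanSpace ℝ ι → EuclideanSpace ℝ ι} (hg : MemLp g 2 volume) {e : EuclideanSpace ℝ ι} (he : ‖e‖ ≤ 1)
    {f w : EuclideanSpace ℝ ι → EuclideanSpace ℝ ι} (hf : MemLp f ∞ volume) (hw : MemLp w 2 volume)
    (hconv : Tendsto (fun N : ℕ => eLpNorm (w - ∑ l ∈ Finset.Icc (-(N : ℤ)) N, blockFn l w) 2 volume) atTop (𝓝 0)) :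
    ‖trilin j g e f w‖ₑ ≤ ∑' l', ‖trilin j g e f (blockFn l' w)‖ₑ :=
  enorm_le_tsum_of_tendsto_sum (tendsto_sum_trilin_blockFn_right j hg he hf hw hconv)

end TwoFields

end Literature.Analysis.FluidPDE

end
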